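import Summits.Ventures.YMGap.Thresholds.OneLinkHolleyStroock
import Summits.Ventures.YMGap.RobustBall.ChargeConjugation
import HarnessLib

/-!
# Complex-conjugation symmetry of the one-link law: `ν_{B̄}` is the image of `ν_B` under `g ↦ ḡ`

HONEST FRAMING.  Exact identities for ONE tilted Haar law on `SU(N)` (explicit strong-coupling bookkeeping for lattice `SU(N)` Yang–Mills,
small `β`); certifies nothing; NOT weak coupling, NOT a continuum statement, NOT a Yang–Mills mass-gap claim.  Cell `pub-ymgap` (venture
`YMGap`), seat engine-2 (g13): the third symmetry of the one-link functionals after bi-invariance `B ↦ UBV` (`Thresholds/OneLinkLawBiInvariance.lean`)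
— it is NOT of the form `UBV` — recorded because every certificate for the schemas `OneLinkVarianceBound` / `OneLinkPoincareSUN` (and the cell's
float engines, which «verified conjugation invariance to 1e−14») may use it to halve the phase range of the representatives `diagonal(u·σ)`.

THE OBJECT.  `ν_B(dg) ∝ exp(N Re tr(g B)) Haar_{SU(N)}(dg)`; `ḡ` = entrywise complex conjugate (the tree's `suConj N : SU(N) →* SU(N)`,
`Literature/MathematicalPhysics/QuantumLattice/CPeriodicBoundaryConditions.lean`), `B̄ := B.map conj`.

CONTENT (folklore; the one-STATE version — charge-conjugation invariance of the infinite-volume state — is ds-3's `RobustBall/ChargeConjugation.lean`,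
whose `map_conj_map_conj` / `re_trace_map_conj` are reused here).  `suConj` is a continuous involutive automorphism of the compact group `SU(N)`, hence Haar-measure preserving
(`measurePreserving_suConj`, Mathlib `MonoidHom.measurePreserving`); `N Re tr(ḡ B) = N Re tr(g B̄)` (`pot_suConj`); so
`∫ ψ dν_{B̄} = ∫ ψ∘suConj dν_B` (`integral_tilted_mapConj`), `Var_{ν_{B̄}}(ψ) = Var_{ν_B}(ψ ∘ suConj)` (`variance_tilted_mapConj`), and in particular
* `variance_linear_mapConj` : `Var_{ν_{B̄}}(N Re tr(gΔ)) = Var_{ν_B}(N Re tr(g Δ̄))`;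
* ★ `varianceBoundAt_mapConj` / `poincareAt_mapConj` : the H2-type bound and the H1-type Lipschitz Poincaré constant AT `B` hold AT `B̄`
  (`‖Δ̄‖_F = ‖Δ‖_F`; `ψ ∘ suConj` is `M`-Lipschitz when `ψ` is, `suFrobDist_suConj`);
* ★ `varianceBoundAt_diagonal_conj` / `poincareAt_diagonal_conj` : for the representatives, a statement at `diagonal(u·σ)` (`σ` real) is a statement at
  `diagonal(ū·σ)` — with the centre `e^{2πi/N}·1 ∈ SU(N)` (bi-invariance) the phase `u` of a certificate ranges over an arc of length `π/N` only.

References: standard (uniqueness of Haar measure); H. Shen, R. Zhu, X. Zhu, CMP 400 (2023) (the one-link law).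
-/

noncomputable section

open scoped Matrix ComplexConjugate BigOperators
open Matrix Complex MeasureTheory ProbabilityTheory
open Literature.MathematicalPhysics.QuantumFieldTheory
open Literature.MathematicalPhysics.QuantumFieldTheory.SUNBakryEmery
open Literature.MathematicalPhysics.QuantumLattice (suConj coe_suConj suConj_suConj)

namespace Summit.Ventures.YMGap.OneLinkConjugation

variable {N : ℕ}

/-! ## 1. `suConj` preserves the Haar probability measure -/

/-- `g ↦ ḡ` is continuous on `SU(N)`. [folklore] -/
theorem continuous_suConj : Continuous (suConj N) :=
  Continuous.subtype_mk (continuous_subtype_val.matrix_map Complex.continuous_conj) _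

/-- `g ↦ ḡ` is surjective (an involution). [folklore] -/
theorem suConj_surjective : Function.Surjective (suConj N) := fun g => ⟨suConj N g, suConj_suConj N g⟩

/-- `g ↦ ḡ` as a measurable embedding (it is a homeomorphism of `SU(N)`). [folklore] -/
theorem measurableEmbedding_suConj : MeasurableEmbedding (suConj N) :=
  (Homeomorph.mk ⟨suConj N, suConj N, suConj_suConj N, suConj_suConj N⟩ continuous_suConj continuous_suConj).toMeasurableEquiv.measurableEmbedding

/-- **`g ↦ ḡ` preserves the Haar probability measure of `SU(N)`** (continuous surjective endomorphism of a compact group; uniqueness of Haar measure).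
[folklore] -/
theorem measurePreserving_suConj : MeasurePreserving (suConj N) (haarProbability (SUN N)) (haarProbability (SUN N)) := by
  haveI : (haarProbability (SUN N)).IsHaarMeasure := Measure.isHaarMeasure_haarMeasure _
  exact MonoidHom.measurePreserving continuous_suConj suConj_surjective rfl

/-- Change of variables `∫ F(ḡ) dσ(g) = ∫ F dσ`. [folklore] -/
theorem integral_comp_suConj (F : SUN N → ℝ) :
    ∫ g, F (suConj N g) ∂(haarProbability (SUN N)) = ∫ g, F g ∂(haarProbability (SUN N)) :=
  measurePreserving_suConj.integral_comp measurableEmbedding_suConj F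

/-! ## 2. The potential and the linear observables under conjugation -/

/-- `ḡ · B = conj(g · B̄)` entrywise. [folklore] -/
theorem coe_suConj_mul (g : SUN N) (B : Matrix (Fin N) (Fin N) ℂ) :
    ((suConj N g : SUN N) : Matrix (Fin N) (Fin N) ℂ) * B = ((g : Matrix (Fin N) (Fin N) ℂ) * B.map (starRingEnd ℂ)).map (starRingEnd ℂ) := by
  rw [Matrix.map_mul, RobustBall.map_conj_map_conj, coe_suConj]

/-- **`N Re tr(ḡ B) = N Re tr(g B̄)`**: the one-link potential of `B̄` is the potential of `B` composed with conjugation. [folklore] -/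
theorem pot_suConj (g : SUN N) (B : Matrix (Fin N) (Fin N) ℂ) :
    (N : ℝ) * (((suConj N g : SUN N) : Matrix (Fin N) (Fin N) ℂ) * B).trace.re =
      (N : ℝ) * ((g : Matrix (Fin N) (Fin N) ℂ) * B.map (starRingEnd ℂ)).trace.re := by
  rw [coe_suConj_mul, RobustBall.re_trace_map_conj]

/-- `‖M̄‖_F = ‖M‖_F`. [folklore] -/
theorem frobNorm_map_conj (M : Matrix (Fin N) (Fin N) ℂ) : frobNorm (M.map (starRingEnd ℂ)) = frobNorm M := by
  unfold frobNorm
  simp only [Matrix.map_apply, Complex.norm_conj]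

/-- The Frobenius distance is conjugation invariant: `d(ā, b̄) = d(a, b)`. [folklore] -/
theorem suFrobDist_suConj (a b : SUN N) : suFrobDist (suConj N a) (suConj N b) = suFrobDist a b := by
  unfold suFrobDist
  rw [coe_suConj, coe_suConj, ← Matrix.map_sub _ (map_sub (starRingEnd ℂ)), frobNorm_map_conj]

/-! ## 3. The tilted law of `B̄` is the conjugation image of the tilted law of `B` -/

/-- Weighted change of variables: `∫ e^{S(ḡ)} ψ(g) dσ = ∫ e^{S(h)} ψ(h̄) dσ`. [folklore] -/
theorem integral_exp_tilt_suConj (S ψ : SUN N → ℝ) :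
    ∫ g, Real.exp (S (suConj N g)) * ψ g ∂(haarProbability (SUN N)) = ∫ h, Real.exp (S h) * ψ (suConj N h) ∂(haarProbability (SUN N)) := by
  have h := integral_comp_suConj (N := N) (fun h => Real.exp (S h) * ψ (suConj N h))
  simp only [suConj_suConj] at h
  exact h

/-- **Tilted expectations**: `∫ ψ dσ^{S∘suConj} = ∫ ψ∘suConj dσ^S`. [folklore] -/
theorem integral_tilted_comp_suConj (S ψ : SUN N → ℝ) :
    ∫ g, ψ g ∂((haarProbability (SUN N)).tilted fun g => S (suConj N g)) = ∫ h, ψ (suConj N h) ∂((haarProbability (SUN N)).tilted S) := by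
  rw [integral_tilted_eq_div, integral_tilted_eq_div, integral_exp_tilt_suConj]
  have hZ : ∫ g, Real.exp (S (suConj N g)) ∂(haarProbability (SUN N)) = ∫ h, Real.exp (S h) ∂(haarProbability (SUN N)) :=
    integral_comp_suConj (fun h => Real.exp (S h))
  rw [hZ]

/-- **Variance**: `Var[ψ; σ^{S∘suConj}] = Var[ψ∘suConj; σ^S]` for continuous `ψ`. [folklore] -/
theorem variance_tilted_comp_suConj (S : SUN N → ℝ) {ψ : SUN N → ℝ} (hψ : Continuous ψ) :
    Var[ψ; (haarProbability (SUN N)).tilted fun g => S (suConj N g)] = Var[fun h => ψ (suConj N h); (haarProbability (SUN N)).tilted S] := by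
  have hψ' : Continuous fun h : SUN N => ψ (suConj N h) := hψ.comp continuous_suConj
  have hm := integral_tilted_comp_suConj S ψ
  rw [ProbabilityTheory.variance_eq_integral hψ.aemeasurable, ProbabilityTheory.variance_eq_integral hψ'.aemeasurable]
  have h2 := integral_tilted_comp_suConj S (fun g => (ψ g - ∫ h, ψ (suConj N h) ∂((haarProbability (SUN N)).tilted S)) ^ 2)
  rw [hm]
  exact h2

/-- **`ν_{B̄} = σ^{S_B ∘ suConj}`**: the tilted law of `B̄` is the Haar law tilted by the potential of `B` composed with conjugation. [folklore] -/
theorem tilted_mapConj_eq (B : Matrix (Fin N) (Fin N) ℂ) :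
    ((haarProbability (SUN N)).tilted fun g : SUN N => (N : ℝ) * ((g : Matrix (Fin N) (Fin N) ℂ) * B.map (starRingEnd ℂ)).trace.re) =
      (haarProbability (SUN N)).tilted fun g : SUN N => (N : ℝ) * (((suConj N g : SUN N) : Matrix (Fin N) (Fin N) ℂ) * B).trace.re := by
  congr 1
  funext g
  exact (pot_suConj g B).symm

/-- **`∫ ψ dν_{B̄} = ∫ ψ∘suConj dν_B`.** [folklore] -/
theorem integral_tilted_mapConj (B : Matrix (Fin N) (Fin N) ℂ) (ψ : SUN N → ℝ) :
    ∫ g, ψ g ∂((haarProbability (SUN N)).tilted fun g : SUN N => (N : ℝ) * ((g : Matrix (Fin N) (Fin N) ℂ) * B.map (starRingEnd ℂ)).trace.re) =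
      ∫ h, ψ (suConj N h) ∂((haarProbability (SUN N)).tilted fun g : SUN N => (N : ℝ) * ((g : Matrix (Fin N) (Fin N) ℂ) * B).trace.re) := by
  rw [tilted_mapConj_eq]
  exact integral_tilted_comp_suConj (fun h : SUN N => (N : ℝ) * ((h : Matrix (Fin N) (Fin N) ℂ) * B).trace.re) ψ

/-- **`Var_{ν_{B̄}}(ψ) = Var_{ν_B}(ψ ∘ suConj)`** for continuous `ψ`. [folklore] -/
theorem variance_tilted_mapConj (B : Matrix (Fin N) (Fin N) ℂ) {ψ : SUN N → ℝ} (hψ : Continuous ψ) :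
    Var[ψ; (haarProbability (SUN N)).tilted fun g : SUN N => (N : ℝ) * ((g : Matrix (Fin N) (Fin N) ℂ) * B.map (starRingEnd ℂ)).trace.re] =
      Var[fun h => ψ (suConj N h); (haarProbability (SUN N)).tilted fun g : SUN N => (N : ℝ) * ((g : Matrix (Fin N) (Fin N) ℂ) * B).trace.re] := by
  rw [tilted_mapConj_eq]
  exact variance_tilted_comp_suConj (fun h : SUN N => (N : ℝ) * ((h : Matrix (Fin N) (Fin N) ℂ) * B).trace.re) hψ

/-! ## 4. ★ The H2-type bound and the H1-type constant are conjugation invariant -/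

/-- ★ **`Var_{ν_{B̄}}(N Re tr(gΔ)) = Var_{ν_B}(N Re tr(g Δ̄))`.** [folklore] -/
theorem variance_linear_mapConj (B Δ : Matrix (Fin N) (Fin N) ℂ) :
    Var[fun g : SUN N => (N : ℝ) * ((g : Matrix (Fin N) (Fin N) ℂ) * Δ).trace.re ;
        (haarProbability (SUN N)).tilted fun g : SUN N => (N : ℝ) * ((g : Matrix (Fin N) (Fin N) ℂ) * B.map (starRingEnd ℂ)).trace.re] =
      Var[fun g : SUN N => (N : ℝ) * ((g : Matrix (Fin N) (Fin N) ℂ) * Δ.map (starRingEnd ℂ)).trace.re ;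
        (haarProbability (SUN N)).tilted fun g : SUN N => (N : ℝ) * ((g : Matrix (Fin N) (Fin N) ℂ) * B).trace.re] := by
  have hψ : Continuous fun g : SUN N => (N : ℝ) * ((g : Matrix (Fin N) (Fin N) ℂ) * Δ).trace.re :=
    continuous_const.mul (continuous_re_trace_su_mul Δ)
  rw [variance_tilted_mapConj B hψ]
  simp only [pot_suConj]

/-- ★ **The linear-observable variance bound AT `B` holds AT `B̄`.** [folklore] -/
theorem varianceBoundAt_mapConj {v : ℝ} {B : Matrix (Fin N) (Fin N) ℂ}
    (h : ∀ Δ : Matrix (Fin N) (Fin N) ℂ,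
      Var[fun g : SUN N => (N : ℝ) * ((g : Matrix (Fin N) (Fin N) ℂ) * Δ).trace.re ;
        (haarProbability (SUN N)).tilted fun g : SUN N => (N : ℝ) * ((g : Matrix (Fin N) (Fin N) ℂ) * B).trace.re] ≤ v * frobNorm Δ ^ 2)
    (Δ : Matrix (Fin N) (Fin N) ℂ) :
    Var[fun g : SUN N => (N : ℝ) * ((g : Matrix (Fin N) (Fin N) ℂ) * Δ).trace.re ;
        (haarProbability (SUN N)).tilted fun g : SUN N => (N : ℝ) * ((g : Matrix (Fin N) (Fin N) ℂ) * B.map (starRingEnd ℂ)).trace.re]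
      ≤ v * frobNorm Δ ^ 2 := by
  rw [variance_linear_mapConj, ← frobNorm_map_conj Δ]
  exact h _

/-- ★ **The Lipschitz Poincaré constant AT `B` holds AT `B̄`.** [folklore] -/
theorem poincareAt_mapConj {c : ℝ} {B : Matrix (Fin N) (Fin N) ℂ}
    (h : ∀ (ψ : SUN N → ℝ) (M : ℝ), 0 ≤ M → (∀ a b : SUN N, |ψ a - ψ b| ≤ M * suFrobDist a b) →
      Var[ψ ; (haarProbability (SUN N)).tilted fun g : SUN N => (N : ℝ) * ((g : Matrix (Fin N) (Fin N) ℂ) * B).trace.re] ≤ c * M ^ 2)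
    (ψ : SUN N → ℝ) (M : ℝ) (hM : 0 ≤ M) (hψ : ∀ a b : SUN N, |ψ a - ψ b| ≤ M * suFrobDist a b) :
    Var[ψ ; (haarProbability (SUN N)).tilted fun g : SUN N => (N : ℝ) * ((g : Matrix (Fin N) (Fin N) ℂ) * B.map (starRingEnd ℂ)).trace.re]
      ≤ c * M ^ 2 := by
  rw [variance_tilted_mapConj B (continuous_of_lipschitz_suFrobDist hψ)]
  refine h _ M hM fun a b => ?_
  have := hψ (suConj N a) (suConj N b)
  rwa [suFrobDist_suConj] at this

/-! ## 5. ★ On the representatives: `conj(diagonal(u·σ)) = diagonal(ū·σ)` -/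

/-- `conj(diagonal(u·σ)) = diagonal(ū·σ)` for real `σ`. [folklore] -/
theorem diagonal_rep_map_conj (u : ℂ) (σ : Fin N → ℝ) :
    (diagonal fun i => u * ((σ i : ℝ) : ℂ)).map (starRingEnd ℂ) = diagonal fun i => starRingEnd ℂ u * ((σ i : ℝ) : ℂ) := by
  rw [Matrix.diagonal_map (map_zero _)]
  congr 1
  funext i
  simp only [map_mul, Complex.conj_ofReal]

/-- ★ **H2 at `diagonal(u·σ)` ⇒ H2 at `diagonal(ū·σ)`** (`σ` real; `‖ū‖ = ‖u‖`). [folklore] -/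
theorem varianceBoundAt_diagonal_conj {v : ℝ} {u : ℂ} {σ : Fin N → ℝ}
    (h : ∀ Δ : Matrix (Fin N) (Fin N) ℂ,
      Var[fun g : SUN N => (N : ℝ) * ((g : Matrix (Fin N) (Fin N) ℂ) * Δ).trace.re ;
        (haarProbability (SUN N)).tilted fun g : SUN N =>
          (N : ℝ) * ((g : Matrix (Fin N) (Fin N) ℂ) * diagonal (fun i => u * ((σ i : ℝ) : ℂ))).trace.re] ≤ v * frobNorm Δ ^ 2)
    (Δ : Matrix (Fin N) (Fin N) ℂ) :
    Var[fun g : SUN N => (N : ℝ) * ((g : Matrix (Fin N) (Fin N) ℂ) * Δ).trace.re ;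
        (haarProbability (SUN N)).tilted fun g : SUN N =>
          (N : ℝ) * ((g : Matrix (Fin N) (Fin N) ℂ) * diagonal (fun i => starRingEnd ℂ u * ((σ i : ℝ) : ℂ))).trace.re] ≤ v * frobNorm Δ ^ 2 := by
  rw [← diagonal_rep_map_conj]
  exact varianceBoundAt_mapConj h Δ

/-- ★ **H1 at `diagonal(u·σ)` ⇒ H1 at `diagonal(ū·σ)`** (`σ` real). [folklore] -/
theorem poincareAt_diagonal_conj {c : ℝ} {u : ℂ} {σ : Fin N → ℝ}
    (h : ∀ (ψ : SUN N → ℝ) (M : ℝ), 0 ≤ M → (∀ a b : SUN N, |ψ a - ψ b| ≤ M * suFrobDist a b) →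
      Var[ψ ; (haarProbability (SUN N)).tilted fun g : SUN N =>
        (N : ℝ) * ((g : Matrix (Fin N) (Fin N) ℂ) * diagonal (fun i => u * ((σ i : ℝ) : ℂ))).trace.re] ≤ c * M ^ 2)
    (ψ : SUN N → ℝ) (M : ℝ) (hM : 0 ≤ M) (hψ : ∀ a b : SUN N, |ψ a - ψ b| ≤ M * suFrobDist a b) :
    Var[ψ ; (haarProbability (SUN N)).tilted fun g : SUN N =>
        (N : ℝ) * ((g : Matrix (Fin N) (Fin N) ℂ) * diagonal (fun i => starRingEnd ℂ u * ((σ i : ℝ) : ℂ))).trace.re] ≤ c * M ^ 2 := by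
  rw [← diagonal_rep_map_conj]
  exact poincareAt_mapConj h ψ M hM hψ

/-- `‖ū‖ = ‖u‖` (so `ū` is again an admissible phase of a representative). [folklore] -/
theorem norm_conj_eq (u : ℂ) : ‖starRingEnd ℂ u‖ = ‖u‖ := Complex.norm_conj u

end Summit.Ventures.YMGap.OneLinkConjugation

end
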